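import Literature.MathematicalPhysics.QuantumFieldTheory.Balaban1983to89.B8Eq1122Concrete
import Literature.MathematicalPhysics.QuantumFieldTheory.Balaban1983to89.B8SectDSource

/-!
# `Balaban1983to89.B8Eq1117Concrete` — T. Bałaban, *Spaces of regular gauge field configurations on a lattice and gauge
# fixing conditions*, Commun. Math. Phys. **99** (1985) 75–102 [Balaban1985RegularSpaces], Sect. E pp. 95–97: the fixed-point
# equation (1.117) `C′(λ − H′X) = X` / the transformation (1.118) and its unique solvability on the set (1.119) («by the
# contraction mapping theorem there exists exactly one solution») — FOR THE CONCRETE LATTICE REMAINDER `C′ = C′_j(u₁, ·)` of (213) [3]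

statement-level skeleton of published theorems with citation tags; proofs where landed; nothing here is a claim about the Yang–Mills mass gap

PDF held: `paper:balaban1985-cmp99-regular-spaces-gauge-fixing` (journal page = PDF page + 74); pp. 96–97 read AS IMAGES on the
renders `run/shared/lean/pub/pub-balaban/b2b-balaban-ref1/pages/1985-cmp99-regular-spaces-gauge-fixing/…-p022-x2.png`, `…-p023-x2.png`,
p. 95 [PDF 21] from the text layer `p0021.txt` (this unit, 2026-08-21); [3] = T. Bałaban, *Averaging operations for lattice gauge
theories*, Commun. Math. Phys. **98** (1985) 17–51 [Balaban1985Averaging], (207)–(208), (213)–(214) p. 50.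

CITATION HEADER (lean-in-tree rule).  Cell `lit-balaban` (HOME `run/shared/lean/pub/lit-balaban/`), unit `lit-balaban-p05` (Phase-2 proof
seat p05, gen 5; TAKING line HOME/STATUS.md 2026-08-21T07:14Z; free-target protocol G.5-34(d); owner of block B8 = `lit-balaban-r05`,
referee ref-4).  WHAT IS REPRODUCED = SKELETON rows **`B8.Eq1.113`** ((1.113)–(1.118) pp. 95–96, typed/proved so far AT THE ABSTRACT
BANACH LEVEL in r05's `B8SectEStatements`: `Eq1117`, `eq1117_existsUnique`, `Dprime`, `Dprime_bound`, `linMap`, `eq1114`) and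
**`B8.Claim@97`**'s first sentences (p. 97: «exactly one solution of Eq. (1.117) … We take `D′(λ)` equal to this solution …
`|D′(λ)| = |C′(λ − H′D′(λ))| < C′₂(α₃ + α₄)α₄`»), HERE for the CONCRETE lattice remainder `C′ = C′_j(u₁, ·)` =
`B8Eq1123Concrete.Cnl` (= `B8Eq178Averages.Qnl − Q′_jλ`) at a general (52) background on the one-level (207)-domain of [3] (files 1–3 of
this series: `B8Eq1123Concrete` (1.123), `B8Ineq125Concrete` (1.124)–(1.125), `B8Eq1122Concrete` (1.122) + Lipschitz), with the
operator `H′` of (1.91)–(1.92) kept ABSTRACT: any `ℂ`-linear map from the `X`-space into the `λ`-configurations obeying the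
(1.92)/(1.120)-type modulus bounds (the lattice `H′ = G′²Q′*(Q′G′²Q′*)⁻¹` is row B8.Eq1.91 / interface I-B8-2 and is not built here).

PRINT (pp. 95–97 [PDF 21–23], verbatim).  «We want to construct a function `D′(λ)` for `α₃, α₄` sufficiently small, whose values are
configurations `X : 𝔅_k → 𝔤`, such that the transformation `λ′ = λ − H′D′(λ)` (1.113) changes the function `Q′(λ′)` into the linear
function `Q′λ`: `Q′(λ − H′D′(λ)) = Q′λ`. (1.114)  Using the equality (213) [3] the above equation can be written in the following form:
`Q′λ − Q′H′D′(λ) + C′(λ − H′D′(λ)) = Q′λ`, (1.115) hence `−D′(λ) + C′(λ − H′D′(λ)) = 0`. (1.116)  The function `D′(λ)` is a solution of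
the equation `C′(λ − H′X) = X`, (1.117) or a fixed point of the transformation `X → C′(λ − H′X)`. (1.118) … Let us assume that
`|λ| < ½α₄, |Dλ| < ½α₄(Lʲη)⁻¹ on Ω_j, |X| < α₄/(2B′₀)`. (1.119)  This implies `|λ − H′X| < α₄, |D(λ − H′X)| < α₄(Lʲη)⁻¹ on Ω_j`, (1.120)
and by the inequality (214) we have `|C′(λ − H′X)| < C′₂(α₃ + α₄)α₄`, (1.121) … The transformation (1.118) maps the set (1.119) of `X`'s
into itself if `C′₂(α₃ + α₄)α₄ ≦ α₄/(2B′₀)`, or `α₃ + α₄ ≦ 1/(2B′₀C′₂)`. … Applying it [(1.125)] to the expression (1.122) we have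
`|C′(λ − H′X₁) − C′(λ − H′X₂)| ≦ C′₂2B′₀(α₃ + α₄)|X₁ − X₂|`, hence the mapping (1.118) is contractive if e.g. `α₃ + α₄ ≦ 1/(4B′₀C′₂)`. If
the last condition is satisfied, then the mapping transforms the set `{|X| < α₄/(2B′₀)}` into itself and is contractive on this set.
Thus by the contraction mapping theorem there exists exactly one solution of Eq. (1.117). … We take `D′(λ)` equal to this solution.
From Eq. (1.116) we can get much better bounds on it: `|D′(λ)| = |C′(λ − H′D′(λ))| < C′₂(α₃ + α₄)α₄`.»  And p. 96, on `H′` (1.92)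
p. 92: «`|H′X|, …` bounded by `B′₀|X|`» in the form used in (1.119) ⇒ (1.120).

WHAT THIS FILE PROVES (kernel, no `sorry`, standard axioms; carriers of the series: `𝔸` a complete normed `ℂ`-algebra with `‖1‖ = 1`,
`U₀` `G`-valued (`G ⊂ U1` average-closed) with (52), `η = L⁻ᵏ`, `u₁ ∈ Λ_k(U₀, α₃)`).
* §0 THE `X`-SPACE «configurations `X : 𝔅_k → 𝔤`» as `XSpace d k 𝔸` = bounded functions on `Fin (k+1) × ℤᵈ` (level `j ≤ k`, site of
  `Ω^{(j)}`) with the sup norm `|X|` (Mathlib `BoundedContinuousFunction` on a discrete space; complete); `CnlF` — the remainder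
  `C′(μ) = (C′_j(u₁, μ)(z))_{j ≤ k, z}` packaged as an element of `XSpace` (value `0` off the set where it is bounded — never used there);
  `CnlF_apply`; `Cnl_bounded_of207` — on the (207)-domain `C′(μ)` IS bounded, by (214) (`B8Eq178Averages.eq214_qprimeIter_of207`).
* §1 `dom120_of_119` — **(1.119) ⇒ (1.120)**: for `λ` in the half-size set and `‖X‖ ≤ α₄/(2B′₀)`, `λ − H′X` lies in the (207)-domain
  (`|λ − H′X| < α₄`, `|D(λ − H′X)| < α₄η⁻¹·η`), from the modulus bounds `|H′X| ≤ B′₀|X|`, `|DH′X| ≤ B′₀|X|` of `H′`.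
* §2 `fpMap` — **(1.118)** the transformation `X → C′(λ − H′X)` on `XSpace`; **`eq1117_existsUnique`** — p. 97 «by the contraction
  mapping theorem there exists exactly one solution of Eq. (1.117)» in the closed ball `‖X‖ ≤ α₄/(2B′₀)` (⊇ print's open set (1.119)),
  PROVED for the concrete `C′`: self-map by (1.121) (`eq214_qprimeIter_of207` at `λ − H′X`, in the domain by §1) and the smallness,
  contraction with constant `½` by the Lipschitz bound of (1.122)/(1.125) (`B8Eq1122Concrete.lipschitz1122`, instance `α₄ ↦ 2α₄` —
  READING (c)), Banach's theorem on the closed ball BY NAME (`B8SectDSource.fixedPoint_closedBall`, r05's abstract engine);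
  `eq1117_pointwise` — the fixed point read sitewise: `C′_j(u₁, λ − H′X)(z) = X(j, z)` for all `j ≤ k`, `z` = (1.117).
* FILE 2 of this pair, `B8Eq1113Concrete` (same unit): `D′(λ)` («We take `D′(λ)` equal to this solution»), its bound «`|D′(λ)| <
  C′₂(α₃ + α₄)α₄`», and (1.114) `Q′(λ − H′D′(λ)) = Q′λ`.
READINGS (recorded; none is an objection to print).  (a) `|·|`, `𝔤ᶜ`-values, `λ := log u′`, ONE-LEVEL (207)-domain: as in files 1–3
(`B8Ineq125Concrete` READINGS (a)–(b)); `𝔅_k` = all levels `j ≤ k` and all sites (print restricts `X` to `Λ_j ⊂ 𝔅_k`; the fixed point on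
the larger index set restricts).  (b) `H′` ABSTRACT: a `ℂ`-linear map `XSpace → (ℤᵈ → 𝔸)` with `‖(H′X)(x)‖ ≤ B′₀‖X‖` and
`‖R(U₀(b))(H′X)(b₊) − (H′X)(b₋)‖ ≤ B′₀‖X‖·L⁻ᵏ` — the form of (1.92) that print uses in (1.119) ⇒ (1.120); the lattice `H′` and `B′₀` of
(1.91)–(1.92) are row B8.Eq1.91 (I-B8-2).  (c) CONSTANTS (HOME/GAPS.md G-B8-17): print's `C′₂` is «the constant `O(1)` in (214)»; the
contraction step uses (1.125) at centres of the FULL-size set (1.120), i.e. (214) on the doubled domain, so the smallness here is print's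
«`α₃ + α₄ ≦ 1/(4B′₀C′₂)`» with `C′₂ := 2·C2p d` (`C2p d = 16·Cgen d` the (207)-form constant of (214)) and the (214)-hypotheses are taken
at `2α₄`; the bound of `D′` keeps `C2p d`.  (d) `≤` for `<` in «`|D′(λ)| < C′₂(α₃ + α₄)α₄`» and the CLOSED ball `‖X‖ ≤ α₄/(2B′₀)` for the
open set (1.119) (it only enlarges the uniqueness domain), as in `B8SectEStatements`.  (e) «This solution is an analytic function of `λ`»
(p. 97) is NOT proved here.  NOT CLAIMED: the lattice `H′`; analyticity of `D′`; the region-dependent form on `{Ω_j}`; the onto sentence of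
p. 97 (row B8.Claim@97: `B8Claim97OntoProof` at the abstract level).
DECLARATIONS: definitions with bodies `XSpace` (abbrev), `CnlF`, `fpMap`; the rest theorems; no `… : Prop` fact is introduced.
REUSED BY NAME: `B8SectDSource.fixedPoint_closedBall` (r05), `B8Eq178Averages.eq214_qprimeIter_of207` (r05), `B8Eq1123Concrete.Cnl,
cjDiff_line`, `B8Ineq125Concrete.C2p, C2p_nonneg`, `B8Eq1122Concrete.lipschitz1122, cjDiff_sub`, `B7Eq78Linearization.QprimeIter,
QprimeIter_add, QprimeIter_smul`, `B8Eq119TwistedAxial.bgT`, `B7Eq170Flat.cj`, `B7Prop10Flat.one_le_C5, C4'_nonneg, C5'_nonneg`,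
`B7Prop10General.C6, C7, C4G`, Mathlib `BoundedContinuousFunction.ofNormedAddCommGroupDiscrete, norm_le, norm_coe_le_norm`.
Unit `lit-balaban-p05` (gen 5), 2026-08-21.

[cite: Balaban1985RegularSpaces, (1.113)–(1.121) pp.95–96, p.97 (solution of (1.117), D′ and its bound); Balaban1985Averaging, (213)–(214)
p.50, (207) p.50]
-/

noncomputable section

open NormedSpace Finset Metric Set
open scoped BoundedContinuousFunction

namespace Literature.MathematicalPhysics.QuantumFieldTheory.Balaban1983to89.B8Eq1117Concrete

open B7Prop1Explicit B7Prop2Explicit MatrixLog B7Eq167Flat B7Prop9Flat B7Prop10General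
open B7Prop10Flat (one_le_C5 C4'_nonneg C5'_nonneg)
open B7Eq78Linearization (zdBlocking QprimeIter QprimeIter_add QprimeIter_smul)
open B7Eq214General (Cgen)
open B7Eq170Flat (cj)
open B8Eq119TwistedAxial (bgT)
open B8Eq178Averages (Qnl eq214_qprimeIter_of207)
open B8Eq1123Concrete (Cnl cjDiff_line)
open B8Ineq125Concrete (C2p C2p_nonneg)
open B8Eq1122Concrete (lipschitz1122 cjDiff_sub)

-- `Site` alone would resolve to the torus sites of `Setup.lean`; re-export the `ℤ^d` sites of `B7Prop1Explicit`.
export B7Prop1Explicit (Site)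

variable {d : ℕ}

/-! ## §0 The `X`-space and the packaged remainder `C′` -/

section XSpaceDefs

variable (d) in
/-- **The `X`-space** — print's «configurations `X : 𝔅_k → 𝔤`» (p. 95) with the sup norm `|X|` of (1.119): bounded `𝔸`-valued functions
on `Fin (k+1) × ℤᵈ` (level `j ≤ k` and site of `Ω^{(j)}`; READING (a)), a complete normed space.
[cite: Balaban1985RegularSpaces, p.95 (before (1.113)), (1.119) p.96] -/
abbrev XSpace (k : ℕ) (𝔸 : Type*) [NormedRing 𝔸] : Type _ := BoundedContinuousFunction (Fin (k + 1) × Site d) 𝔸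

variable {𝔸 : Type*} [NormedRing 𝔸] [NormedAlgebra ℂ 𝔸] [CompleteSpace 𝔸]

open Classical in
/-- **`C′(μ)` as an element of the `X`-space**: the family `(C′_j(u₁, μ)(z))_{j ≤ k, z}` of the concrete remainders
(`B8Eq1123Concrete.Cnl`) packaged as a bounded function when it is bounded (it is, on the (207)-domain: `Cnl_bounded_of207`), `0`
otherwise (off the domain print does not use `C′`). [cite: Balaban1985RegularSpaces, (1.117)–(1.118) p.96; Balaban1985Averaging, (213) p.50] -/
def CnlF (L : ℕ) (U₀ : Site d → Fin d → 𝔸ˣ) (u₁ : Site d → 𝔸ˣ) (k : ℕ) (μ : Site d → 𝔸) : XSpace d k 𝔸 :=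
  if h : ∃ C : ℝ, ∀ p : Fin (k + 1) × Site d, ‖Cnl L U₀ u₁ p.1 μ p.2‖ ≤ C then
    BoundedContinuousFunction.ofNormedAddCommGroupDiscrete (fun p : Fin (k + 1) × Site d => Cnl L U₀ u₁ p.1 μ p.2) h.choose
      h.choose_spec
  else 0

/-- On a bounded family the packaged `C′(μ)` evaluates to `C′_j(u₁, μ)(z)`. [cite: Balaban1985RegularSpaces, (1.117) p.96] (elementary
API; our proof) -/
theorem CnlF_apply {L : ℕ} {U₀ : Site d → Fin d → 𝔸ˣ} {u₁ : Site d → 𝔸ˣ} {k : ℕ} {μ : Site d → 𝔸}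
    (h : ∃ C : ℝ, ∀ p : Fin (k + 1) × Site d, ‖Cnl L U₀ u₁ p.1 μ p.2‖ ≤ C) (p : Fin (k + 1) × Site d) :
    CnlF L U₀ u₁ k μ p = Cnl L U₀ u₁ p.1 μ p.2 := by
  unfold CnlF
  rw [dif_pos h]
  rfl

end XSpaceDefs

section Bounded

variable {𝔸 : Type*} [NormedRing 𝔸] [NormOneClass 𝔸] [NormedAlgebra ℂ 𝔸] [CompleteSpace 𝔸]

/-- **(1.121) / (214) makes `C′(μ)` a bounded family**: for `μ` in the (207)-domain (= print's (1.120)), `‖C′_j(u₁, μ)(z)‖ ≤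
C2p·(α₃ + α₄)·α₄` uniformly in `j ≤ k`, `z` (`eq214_qprimeIter_of207` and `LʲL⁻ᵏ ≤ 1`). [cite: Balaban1985RegularSpaces, (1.121) p.96;
Balaban1985Averaging, (214) p.50] -/
theorem norm_Cnl_le_of207 {L : ℕ} (hL : 2 ≤ L) {G : Subgroup 𝔸ˣ} (hG : AvgClosed d L G) {U₀ : Site d → Fin d → 𝔸ˣ}
    (hU : ∀ x κ, U₀ x κ ∈ G) {k : ℕ} {μ : Site d → 𝔸} {u₁ : Site d → 𝔸ˣ} {α₀ α₃ α₄ : ℝ}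
    (hα : 0 < α₀) (hα3 : C0 d * α₀ ≤ 1 / 3) (hα2 : 2 * α₀ ≤ c2' d L)
    (h52 : pdev U₀ < α₀ * (((L : ℝ) ^ k)⁻¹) ^ 2)
    (h207a : ∀ (x : Site d) (κ : Fin d), ‖cj (U₀ x κ) (μ (x + e κ)) - μ x‖ < α₄ * ((L : ℝ) ^ k)⁻¹)
    (h207b : ∀ x : Site d, ‖μ x‖ < α₄)
    (hu₁ : InLambda L U₀ u₁ k α₃ (((L : ℝ) ^ k)⁻¹))
    (hα₃ : 0 ≤ α₃) (hα₃' : α₃ ≤ 1 / 200)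
    (hs₁ : 200 * C6 d * α₄ ≤ 1) (hs₂ : 12000 * ((d : ℝ) + 1) * L * α₄ ≤ 1) (hs₃ : C4G d L * (α₀ + α₃ + 4 * α₄) ≤ 1)
    (hs₄ : 1024 * ((d : ℝ) + 1) * ((d : ℝ) + 4) * L ^ 2 * α₀ ≤ 1) (hs₅ : 32 * ((d : ℝ) + 1) ^ 2 * C6 d * L ^ 2 * α₀ ≤ 1)
    (hs₆ : 16 * d * C5' d * C6 d * (L : ℝ) ^ 2 * α₀ ≤ 1) (hs₇ : 8 * d * C6 d * L * α₀ ≤ 1) :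
    ∀ j ≤ k, ∀ z : Site d, ‖Cnl L U₀ u₁ j μ z‖ ≤ C2p d * (α₃ + α₄) * α₄ := by
  intro j hj z
  have h := eq214_qprimeIter_of207 hL hG hU hα hα3 hα2 h52 h207a h207b hu₁ hα₃ hα₃' hs₁ hs₂ hs₃ hs₄ hs₅ hs₆ hs₇ j hj z
  have hα₄ : 0 ≤ α₄ := (norm_nonneg _).trans (h207b 0).le
  have hLr : (1 : ℝ) ≤ L := by exact_mod_cast le_trans (by norm_num) hL
  have ht : (L : ℝ) ^ j * ((L : ℝ) ^ k)⁻¹ ≤ 1 := by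
    rw [← div_eq_mul_inv, div_le_one (by positivity)]
    exact pow_le_pow_right₀ hLr hj
  have h0 : 0 ≤ 16 * Cgen d * (α₃ * α₄ + α₄ ^ 2) := by
    have := C2p_nonneg d; unfold C2p at this; positivity
  calc ‖Cnl L U₀ u₁ j μ z‖ ≤ 16 * Cgen d * (α₃ * α₄ + α₄ ^ 2) * ((L : ℝ) ^ j * ((L : ℝ) ^ k)⁻¹) := h
    _ ≤ 16 * Cgen d * (α₃ * α₄ + α₄ ^ 2) * 1 := mul_le_mul_of_nonneg_left ht h0
    _ = C2p d * (α₃ + α₄) * α₄ := by rw [C2p]; ring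

end Bounded

/-! ## §1 (1.119) ⇒ (1.120) for `λ − H′X`, with `H′` abstract -/

section Dom

variable {𝔸 : Type*} [NormedRing 𝔸] [NormedAlgebra ℂ 𝔸]

/-- **(1.119) ⇒ (1.120)** (p. 96: «Let us assume that `|λ| < ½α₄, |Dλ| < ½α₄(Lʲη)⁻¹ on Ω_j, |X| < α₄/(2B′₀)`. (1.119)  This implies
`|λ − H′X| < α₄, |D(λ − H′X)| < α₄(Lʲη)⁻¹ on Ω_j`, (1.120)»), concretely: `λ` in the half-size set (one-level form, scale `s = L⁻ᵏ`),
`‖X‖ ≤ α₄/(2B′₀)`, and `H′` with `‖(H′X)(x)‖ ≤ B′₀‖X‖`, `‖R(U₀(b))(H′X)(b₊) − (H′X)(b₋)‖ ≤ B′₀‖X‖·s` (READING (b)) give `λ − H′X` in the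
(207)-domain. [cite: Balaban1985RegularSpaces, (1.119)–(1.120) p.96] -/
theorem dom120_of_119 {k : ℕ} {U₀ : Site d → Fin d → 𝔸ˣ} (H' : XSpace d k 𝔸 →ₗ[ℂ] (Site d → 𝔸)) {B₀' α₄ s : ℝ}
    (hB : 0 < B₀') (hs : 0 ≤ s)
    (hH0 : ∀ (X : XSpace d k 𝔸) (x : Site d), ‖H' X x‖ ≤ B₀' * ‖X‖)
    (hH1 : ∀ (X : XSpace d k 𝔸) (x : Site d) (κ : Fin d), ‖cj (U₀ x κ) (H' X (x + e κ)) - H' X x‖ ≤ B₀' * ‖X‖ * s)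
    {lam : Site d → 𝔸}
    (h119a : ∀ (x : Site d) (κ : Fin d), ‖cj (U₀ x κ) (lam (x + e κ)) - lam x‖ < α₄ / 2 * s)
    (h119b : ∀ x : Site d, ‖lam x‖ < α₄ / 2)
    {X : XSpace d k 𝔸} (hX : ‖X‖ ≤ α₄ / (2 * B₀')) :
    (∀ (x : Site d) (κ : Fin d), ‖cj (U₀ x κ) ((lam - H' X) (x + e κ)) - (lam - H' X) x‖ < α₄ * s) ∧
      ∀ x : Site d, ‖(lam - H' X) x‖ < α₄ := by
  have hBX : B₀' * ‖X‖ ≤ α₄ / 2 := by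
    calc B₀' * ‖X‖ ≤ B₀' * (α₄ / (2 * B₀')) := mul_le_mul_of_nonneg_left hX hB.le
      _ = α₄ / 2 := by field_simp
  refine ⟨fun x κ => ?_, fun x => ?_⟩
  · rw [cjDiff_sub]
    calc ‖cj (U₀ x κ) (lam (x + e κ)) - lam x - (cj (U₀ x κ) (H' X (x + e κ)) - H' X x)‖
        ≤ ‖cj (U₀ x κ) (lam (x + e κ)) - lam x‖ + ‖cj (U₀ x κ) (H' X (x + e κ)) - H' X x‖ := norm_sub_le _ _
      _ ≤ ‖cj (U₀ x κ) (lam (x + e κ)) - lam x‖ + B₀' * ‖X‖ * s := by gcongr; exact hH1 X x κ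
      _ ≤ ‖cj (U₀ x κ) (lam (x + e κ)) - lam x‖ + α₄ / 2 * s := by gcongr
      _ < α₄ / 2 * s + α₄ / 2 * s := by linarith [h119a x κ]
      _ = α₄ * s := by ring
  · calc ‖(lam - H' X) x‖ = ‖lam x - H' X x‖ := rfl
      _ ≤ ‖lam x‖ + ‖H' X x‖ := norm_sub_le _ _
      _ ≤ ‖lam x‖ + B₀' * ‖X‖ := by gcongr; exact hH0 X x
      _ < α₄ / 2 + α₄ / 2 := by linarith [h119b x]
      _ = α₄ := by ring

end Dom

/-! ## §2 (1.118) and the contraction mapping theorem for the concrete `C′` -/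

section FixedPoint

variable {𝔸 : Type*} [NormedRing 𝔸] [NormOneClass 𝔸] [NormedAlgebra ℂ 𝔸] [CompleteSpace 𝔸]

omit [NormOneClass 𝔸] in
/-- **(1.118)** «a fixed point of the transformation `X → C′(λ − H′X)`» — the transformation on the `X`-space, for the concrete `C′`
and an abstract `H′`. [cite: Balaban1985RegularSpaces, (1.118) p.96] -/
def fpMap (L : ℕ) (U₀ : Site d → Fin d → 𝔸ˣ) (u₁ : Site d → 𝔸ˣ) (k : ℕ) (H' : XSpace d k 𝔸 →ₗ[ℂ] (Site d → 𝔸))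
    (lam : Site d → 𝔸) (X : XSpace d k 𝔸) : XSpace d k 𝔸 :=
  CnlF L U₀ u₁ k (lam - H' X)

/-- **«by the contraction mapping theorem there exists exactly one solution of Eq. (1.117)»** (p. 97) FOR THE CONCRETE `C′ = C′_j(u₁, ·)`:
for `λ` in the half-size set (1.119) (`‖R(U₀(b))λ(b₊) − λ(b₋)‖ < ½α₄L⁻ᵏ`, `‖λ(x)‖ < ½α₄`), an abstract `H′` with the modulus bounds of
READING (b), and print's smallness «`α₃ + α₄ ≦ 1/(4B′₀C′₂)`» with `C′₂ := 2·C2p d` (READING (c); the (214)-hypotheses at `2α₄`), the map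
(1.118) has EXACTLY ONE fixed point in the closed ball `‖X‖ ≤ α₄/(2B′₀)`.  Proof = print's: (1.119) ⇒ (1.120) (`dom120_of_119`); self-map
by (1.121) (`norm_Cnl_le_of207`) and `C′₂(α₃ + α₄)α₄ ≤ α₄/(2B′₀)`; contraction with constant `½` by the Lipschitz bound of (1.122)/(1.125)
(`B8Eq1122Concrete.lipschitz1122` at `2α₄`, modulus `m = B′₀‖X₁ − X₂‖`); Banach's theorem on the closed ball
(`B8SectDSource.fixedPoint_closedBall`).  Abstract twin: `B8SectEStatements.eq1117_existsUnique`.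
[cite: Balaban1985RegularSpaces, (1.117)–(1.121) pp.96–97, p.97 (contraction, exactly one solution)] -/
theorem eq1117_existsUnique {L : ℕ} (hL : 2 ≤ L) {G : Subgroup 𝔸ˣ} (hG : AvgClosed d L G) {U₀ : Site d → Fin d → 𝔸ˣ}
    (hU : ∀ x κ, U₀ x κ ∈ G) {k : ℕ} (H' : XSpace d k 𝔸 →ₗ[ℂ] (Site d → 𝔸)) (lam : Site d → 𝔸)
    {u₁ : Site d → 𝔸ˣ} {α₀ α₃ α₄ B₀' : ℝ}
    (hα : 0 < α₀) (hα3 : C0 d * α₀ ≤ 1 / 3) (hα2 : 2 * α₀ ≤ c2' d L)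
    (h52 : pdev U₀ < α₀ * (((L : ℝ) ^ k)⁻¹) ^ 2)
    (hB : 0 < B₀')
    (hH0 : ∀ (X : XSpace d k 𝔸) (x : Site d), ‖H' X x‖ ≤ B₀' * ‖X‖)
    (hH1 : ∀ (X : XSpace d k 𝔸) (x : Site d) (κ : Fin d),
      ‖cj (U₀ x κ) (H' X (x + e κ)) - H' X x‖ ≤ B₀' * ‖X‖ * ((L : ℝ) ^ k)⁻¹)
    (h119a : ∀ (x : Site d) (κ : Fin d), ‖cj (U₀ x κ) (lam (x + e κ)) - lam x‖ < α₄ / 2 * ((L : ℝ) ^ k)⁻¹)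
    (h119b : ∀ x : Site d, ‖lam x‖ < α₄ / 2)
    (hu₁ : InLambda L U₀ u₁ k α₃ (((L : ℝ) ^ k)⁻¹))
    (hα₃ : 0 ≤ α₃) (hα₃' : α₃ ≤ 1 / 200)
    (hs₁ : 200 * C6 d * (2 * α₄) ≤ 1) (hs₂ : 12000 * ((d : ℝ) + 1) * L * (2 * α₄) ≤ 1)
    (hs₃ : C4G d L * (α₀ + α₃ + 4 * (2 * α₄)) ≤ 1)
    (hs₄ : 1024 * ((d : ℝ) + 1) * ((d : ℝ) + 4) * L ^ 2 * α₀ ≤ 1) (hs₅ : 32 * ((d : ℝ) + 1) ^ 2 * C6 d * L ^ 2 * α₀ ≤ 1)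
    (hs₆ : 16 * d * C5' d * C6 d * (L : ℝ) ^ 2 * α₀ ≤ 1) (hs₇ : 8 * d * C6 d * L * α₀ ≤ 1)
    (hsm : α₃ + α₄ ≤ 1 / (4 * B₀' * (2 * C2p d))) :
    ∃! X : XSpace d k 𝔸, ‖X‖ ≤ α₄ / (2 * B₀') ∧ fpMap L U₀ u₁ k H' lam X = X := by
  have hα₄ : 0 < α₄ := by linarith [norm_nonneg (lam 0), h119b 0]
  have hs : (0 : ℝ) ≤ ((L : ℝ) ^ k)⁻¹ := by positivity
  have hC2 : 0 ≤ C2p d := C2p_nonneg d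
  have hC2pos : 0 < C2p d := by
    have hC6 : (2 : ℝ) ≤ C6 d := by unfold C6; linarith [one_le_C5 (d := d)]
    unfold C2p Cgen; positivity
  -- the (214)-hypotheses at `α₄` follow from those at `2α₄`
  have hC4G : 0 ≤ C4G d L := by
    have h6 : (0 : ℝ) ≤ C6 d := by unfold C6; linarith [one_le_C5 (d := d)]
    have h7 : (0 : ℝ) ≤ C7 d := by unfold C7 C6; linarith [one_le_C5 (d := d), C5'_nonneg (d := d)]
    have h4' := C4'_nonneg (d := d)
    unfold C4G; positivity
  have hs₁' : 200 * C6 d * α₄ ≤ 1 := by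
    have : (0 : ℝ) ≤ C6 d := by unfold C6; linarith [one_le_C5 (d := d)]
    nlinarith
  have hs₂' : 12000 * ((d : ℝ) + 1) * L * α₄ ≤ 1 := by
    have : (0 : ℝ) ≤ 12000 * ((d : ℝ) + 1) * L := by positivity
    nlinarith
  have hs₃' : C4G d L * (α₀ + α₃ + 4 * α₄) ≤ 1 := by nlinarith
  -- print's smallness in product form
  have hprod : C2p d * (α₃ + α₄) * B₀' ≤ 1 / 8 := by
    have h1 : (α₃ + α₄) * (4 * B₀' * (2 * C2p d)) ≤ 1 := by
      have := mul_le_mul_of_nonneg_right hsm (by positivity : (0 : ℝ) ≤ 4 * B₀' * (2 * C2p d))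
      rwa [one_div, inv_mul_cancel₀ (by positivity)] at this
    nlinarith
  have hρ : 0 ≤ α₄ / (2 * B₀') := by positivity
  -- membership of `λ − H′X` in the (207)-domain for `X` in the ball
  have hdom : ∀ X : XSpace d k 𝔸, ‖X‖ ≤ α₄ / (2 * B₀') →
      (∀ (x : Site d) (κ : Fin d), ‖cj (U₀ x κ) ((lam - H' X) (x + e κ)) - (lam - H' X) x‖ < α₄ * ((L : ℝ) ^ k)⁻¹) ∧
        ∀ x : Site d, ‖(lam - H' X) x‖ < α₄ :=
    fun X hX => dom120_of_119 H' hB hs hH0 hH1 h119a h119b hX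
  have hbdd : ∀ X : XSpace d k 𝔸, ‖X‖ ≤ α₄ / (2 * B₀') →
      ∃ C : ℝ, ∀ p : Fin (k + 1) × Site d, ‖Cnl L U₀ u₁ p.1 (lam - H' X) p.2‖ ≤ C := fun X hX =>
    ⟨C2p d * (α₃ + α₄) * α₄, fun p => norm_Cnl_le_of207 hL hG hU hα hα3 hα2 h52 (hdom X hX).1 (hdom X hX).2 hu₁ hα₃ hα₃'
      hs₁' hs₂' hs₃' hs₄ hs₅ hs₆ hs₇ p.1 (Nat.le_of_lt_succ p.1.isLt) p.2⟩
  refine B8SectDSource.fixedPoint_closedBall (fpMap L U₀ u₁ k H' lam) hρ (κ := 1 / 2) (by norm_num) (by norm_num) ?_ ?_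
  · -- self-map: (1.121) and `C′₂(α₃ + α₄)α₄ ≤ α₄/(2B′₀)`
    intro X hX
    have hle : C2p d * (α₃ + α₄) * α₄ ≤ α₄ / (2 * B₀') := by
      rw [le_div_iff₀ (by positivity)]
      nlinarith
    refine (BoundedContinuousFunction.norm_le hρ).2 fun p => ?_
    rw [fpMap, CnlF_apply (hbdd X hX)]
    exact (norm_Cnl_le_of207 hL hG hU hα hα3 hα2 h52 (hdom X hX).1 (hdom X hX).2 hu₁ hα₃ hα₃' hs₁' hs₂' hs₃' hs₄ hs₅
      hs₆ hs₇ p.1 (Nat.le_of_lt_succ p.1.isLt) p.2).trans hle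
  · -- contraction: the Lipschitz bound of (1.122)/(1.125) at `2α₄`, modulus `m = B′₀‖X − Y‖`
    intro X Y hX hY
    have h2 : 2 * α₄ / 2 = α₄ := by ring
    obtain ⟨hXa, hXb⟩ := hdom X hX
    obtain ⟨hYa, hYb⟩ := hdom Y hY
    have hXa' : ∀ (x : Site d) (κ : Fin d),
        ‖cj (U₀ x κ) ((lam - H' X) (x + e κ)) - (lam - H' X) x‖ < 2 * α₄ / 2 * ((L : ℝ) ^ k)⁻¹ := by rw [h2]; exact hXa
    have hYa' : ∀ (x : Site d) (κ : Fin d),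
        ‖cj (U₀ x κ) ((lam - H' Y) (x + e κ)) - (lam - H' Y) x‖ < 2 * α₄ / 2 * ((L : ℝ) ^ k)⁻¹ := by rw [h2]; exact hYa
    have hXb' : ∀ x : Site d, ‖(lam - H' X) x‖ < 2 * α₄ / 2 := by rw [h2]; exact hXb
    have hYb' : ∀ x : Site d, ‖(lam - H' Y) x‖ < 2 * α₄ / 2 := by rw [h2]; exact hYb
    have hdiff : lam - H' X - (lam - H' Y) = H' (Y - X) := by rw [map_sub]; abel
    have hma : ∀ (x : Site d) (κ : Fin d),
        ‖cj (U₀ x κ) ((lam - H' X - (lam - H' Y)) (x + e κ)) - (lam - H' X - (lam - H' Y)) x‖ ≤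
          B₀' * ‖X - Y‖ * ((L : ℝ) ^ k)⁻¹ := fun x κ => by
      rw [hdiff, norm_sub_rev X Y]; exact hH1 (Y - X) x κ
    have hmb : ∀ x : Site d, ‖(lam - H' X - (lam - H' Y)) x‖ ≤ B₀' * ‖X - Y‖ := fun x => by
      rw [hdiff, norm_sub_rev X Y]; exact hH0 (Y - X) x
    have hs₃'' : C4G d L * (α₀ + α₃ + 4 * (2 * α₄)) ≤ 1 := hs₃
    have hlip := lipschitz1122 hL hG hU (lam - H' X) (lam - H' Y) hα hα3 hα2 h52 hXa' hXb' hYa' hYb' hma hmb hu₁ hα₃ hα₃'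
      hs₁ hs₂ hs₃'' hs₄ hs₅ hs₆ hs₇
    have hκ : C2p d * (2 * (B₀' * ‖X - Y‖)) * (α₃ + 2 * α₄) ≤ 1 / 2 * ‖X - Y‖ := by
      have hXY := norm_nonneg (X - Y)
      nlinarith [mul_nonneg (mul_nonneg hC2 hB.le) hXY, mul_nonneg hα₃ hXY]
    refine (BoundedContinuousFunction.norm_le (by positivity)).2 fun p => ?_
    have hLr : (1 : ℝ) ≤ L := by exact_mod_cast le_trans (by norm_num) hL
    have ht : (L : ℝ) ^ (p.1 : ℕ) * ((L : ℝ) ^ k)⁻¹ ≤ 1 := by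
      rw [← div_eq_mul_inv, div_le_one (by positivity)]
      exact pow_le_pow_right₀ hLr (Nat.le_of_lt_succ p.1.isLt)
    rw [BoundedContinuousFunction.coe_sub, Pi.sub_apply, fpMap, fpMap, CnlF_apply (hbdd X hX), CnlF_apply (hbdd Y hY)]
    have h := hlip p.1 (Nat.le_of_lt_succ p.1.isLt) p.2
    have h0 : 0 ≤ C2p d * (2 * (B₀' * ‖X - Y‖)) * (α₃ + 2 * α₄) := by positivity
    calc _ ≤ _ := h
      _ ≤ C2p d * (2 * (B₀' * ‖X - Y‖)) * (α₃ + 2 * α₄) * 1 := mul_le_mul_of_nonneg_left ht h0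
      _ ≤ 1 / 2 * ‖X - Y‖ := by rw [mul_one]; exact hκ

/-- **(1.117) read sitewise**: a fixed point `X` of (1.118) in the ball satisfies `C′_j(u₁, λ − H′X)(z) = X(j, z)` for all `j ≤ k` and
all sites `z` — the equation «`C′(λ − H′X) = X`» (1.117) for the concrete remainder (hypotheses as in `eq1117_existsUnique`, which put
`λ − H′X` in the domain where `C′` is the genuine family). [cite: Balaban1985RegularSpaces, (1.117) p.96] -/
theorem eq1117_pointwise {L : ℕ} (hL : 2 ≤ L) {G : Subgroup 𝔸ˣ} (hG : AvgClosed d L G) {U₀ : Site d → Fin d → 𝔸ˣ}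
    (hU : ∀ x κ, U₀ x κ ∈ G) {k : ℕ} (H' : XSpace d k 𝔸 →ₗ[ℂ] (Site d → 𝔸)) (lam : Site d → 𝔸)
    {u₁ : Site d → 𝔸ˣ} {α₀ α₃ α₄ B₀' : ℝ}
    (hα : 0 < α₀) (hα3 : C0 d * α₀ ≤ 1 / 3) (hα2 : 2 * α₀ ≤ c2' d L)
    (h52 : pdev U₀ < α₀ * (((L : ℝ) ^ k)⁻¹) ^ 2)
    (hB : 0 < B₀')
    (hH0 : ∀ (X : XSpace d k 𝔸) (x : Site d), ‖H' X x‖ ≤ B₀' * ‖X‖)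
    (hH1 : ∀ (X : XSpace d k 𝔸) (x : Site d) (κ : Fin d),
      ‖cj (U₀ x κ) (H' X (x + e κ)) - H' X x‖ ≤ B₀' * ‖X‖ * ((L : ℝ) ^ k)⁻¹)
    (h119a : ∀ (x : Site d) (κ : Fin d), ‖cj (U₀ x κ) (lam (x + e κ)) - lam x‖ < α₄ / 2 * ((L : ℝ) ^ k)⁻¹)
    (h119b : ∀ x : Site d, ‖lam x‖ < α₄ / 2)
    (hu₁ : InLambda L U₀ u₁ k α₃ (((L : ℝ) ^ k)⁻¹))
    (hα₃ : 0 ≤ α₃) (hα₃' : α₃ ≤ 1 / 200)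
    (hs₁ : 200 * C6 d * α₄ ≤ 1) (hs₂ : 12000 * ((d : ℝ) + 1) * L * α₄ ≤ 1) (hs₃ : C4G d L * (α₀ + α₃ + 4 * α₄) ≤ 1)
    (hs₄ : 1024 * ((d : ℝ) + 1) * ((d : ℝ) + 4) * L ^ 2 * α₀ ≤ 1) (hs₅ : 32 * ((d : ℝ) + 1) ^ 2 * C6 d * L ^ 2 * α₀ ≤ 1)
    (hs₆ : 16 * d * C5' d * C6 d * (L : ℝ) ^ 2 * α₀ ≤ 1) (hs₇ : 8 * d * C6 d * L * α₀ ≤ 1)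
    {X : XSpace d k 𝔸} (hX : ‖X‖ ≤ α₄ / (2 * B₀')) (hfix : fpMap L U₀ u₁ k H' lam X = X) :
    ∀ (j : ℕ) (hj : j ≤ k) (z : Site d), Cnl L U₀ u₁ j (lam - H' X) z = X (⟨j, Nat.lt_succ_of_le hj⟩, z) := by
  intro j hj z
  have hs : (0 : ℝ) ≤ ((L : ℝ) ^ k)⁻¹ := by positivity
  obtain ⟨ha, hb⟩ := dom120_of_119 H' hB hs hH0 hH1 h119a h119b hX
  have hbdd : ∃ C : ℝ, ∀ p : Fin (k + 1) × Site d, ‖Cnl L U₀ u₁ p.1 (lam - H' X) p.2‖ ≤ C :=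
    ⟨C2p d * (α₃ + α₄) * α₄, fun p => norm_Cnl_le_of207 hL hG hU hα hα3 hα2 h52 ha hb hu₁ hα₃ hα₃' hs₁ hs₂ hs₃ hs₄ hs₅ hs₆
      hs₇ p.1 (Nat.le_of_lt_succ p.1.isLt) p.2⟩
  have h := congrArg (fun Y : XSpace d k 𝔸 => Y (⟨j, Nat.lt_succ_of_le hj⟩, z)) hfix
  simp only [fpMap] at h
  rw [CnlF_apply hbdd] at h
  exact h

end FixedPoint

end Literature.MathematicalPhysics.QuantumFieldTheory.Balaban1983to89.B8Eq1117Concrete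

end
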